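import Literature.NumberTheory.GaloisCohomology.Howard2004.FiniteSingularTameAdmissible
import Literature.NumberTheory.GaloisCohomology.Howard2004.TowerMorphism
import HarnessLib

/-!
# Howard 2004, Def. 1.1.8 / display (ks relations) across an `𝔪`-adic tower: the tame slot with a
# LEVEL-INDEPENDENT guard, its naturality along reduction maps, and its admissibility

Topic `NumberTheory/GaloisCohomology/Howard2004` (sequel to `FiniteSingularTameAdmissible`; cell
`pub/bsd-print-x9`, lit g32, obligation (n1) — the glue to `DVRSetting.SatisfiesH.fs_natural` /
`fs_admissible` and to `CoeffTowerSetting.FsAdmissible`).  ONE DEFINITION WITH BODY (`tameSlotOn`)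
and theorems; no named fact, no instance, no `sorry`.

Howard's Kolyvagin systems over a discrete valuation ring (§1.6) are towers of systems over the
principal Artinian levels `R/𝔪^k` [arXiv:1202.6340 p. 11, L45–54], and the finite–singular maps
`φ^{fs}_ℓ` of display (ks relations) commute with the reductions `T^{(k+1)}/I_n → T^{(k)}/I_n`
(«evaluation at the Frobenius» and «`c ⊗ α ↦ c(σ_α)`» are functorial in the module, Prop. 1.1.7).
The tree's `DVRSetting.SatisfiesH.fs_natural` asks this for EVERY pair `(n, v)` (not only
`λ ∈ n ∈ 𝓝(𝓛)`), so the slot must be guarded by a predicate that does not depend on the level: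

* §1 **`TamePin.fs_natural_of_eval`** — naturality of `TamePin.fs` along ANY additive
  `Φ : H¹(K_v, N₁) → H¹(K_v, N₂)` acting on cocycle values through an additive `g : N₁ → N₂`, with
  ANY map `Ψ` of singular quotients compatible with `Φ` (covers `localH1Map`, `ContinuousRep.cohomologyMap`,
  `DVRSetting.rqLocH1`/`fsQ`); `exists_cocycle_cohomologyMap` (the cocycle-value hypothesis for
  `ContinuousRep.cohomologyMap`).
* §2 **`tameSlotOn π ρq P hP`** — Howard's map with the pins `π` at the pairs `(n, v)` selected by a
  guard `P` (any predicate implying the hypotheses of Def. 1.1.8 there), `0` elsewhere;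
  `tameSlotOn_natural` — for two families of presentations with THE SAME guard, the slots commute
  with every value-compatible `Φ`/`Ψ` at EVERY `(n, v)` (both sides vanish off `P`);
  `tameSlotOn_natural_cohomologyMap` (the `DVRSetting.fs_natural` shape).
* §3 **`LevelData.isFsAdmissible_of_fs_eq_tameSlotOn`** — admissible as soon as `P` contains the
  level pairs `λ ∈ n ∈ 𝓝(𝓛)`; `tameHyp_of_mem_level_of_h0` packages the guard proof for the natural
  choice `P n v := ↑n ⊆ 𝓛 ∧ v ∈ n` under H.0.
BSD is not proved by any of this.

References: B. Howard, Compositio Math. 140 (2004), Prop. 1.1.7, Def. 1.1.8, Def. 1.2.3, §1.6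
(arXiv:1202.6340 pp. 5–7, 11).
-/

set_option autoImplicit false

noncomputable section

open Function Field ValuativeRel NumberField IsDedekindDomain
open scoped Classical TensorProduct NumberField

namespace Literature.NumberTheory.GaloisCohomology.Howard2004

open Literature.NumberTheory.GaloisRepresentations
open Literature.NumberTheory.GaloisRepresentations.DiscreteGaloisModule
open Literature.NumberTheory.GaloisRepresentations.IsNonarchimedeanLocalField
open Literature.NumberTheory.Automorphic

/-! ## §1 Naturality of `TamePin.fs` along any value-compatible map of local cohomology -/

section Natural

variable {K : Type} [Field K] [NumberField K] {v : HeightOneSpectrum (𝓞 K)}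
  {N₁ : Type} [AddCommGroup N₁] [TopologicalSpace N₁] [DiscreteTopology N₁]
  {N₂ : Type} [AddCommGroup N₂] [TopologicalSpace N₂] [DiscreteTopology N₂]

/-- If `Φ : H¹(K_v, N₁) → H¹(K_v, N₂)` acts on cocycle values through `g` (every class `[z]` goes to a
class `[z']` with `z' = g ∘ z`), then `Φ` commutes with evaluation: `(Φ c)(γ) = g (c(γ))`.
[cite: Howard2004HeegnerKolyvagin, Prop. 1.1.7 (arXiv p. 5, L137–141: functoriality of evaluation)] -/
theorem evalClass_eq_of_exists_cocycle (ρ₁ : DiscreteGaloisModule (v.adicCompletion K) N₁)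
    (ρ₂ : DiscreteGaloisModule (v.adicCompletion K) N₂)
    (htriv₁ : ∀ (σ : absoluteGaloisGroup (v.adicCompletion K)) (x : N₁), ρ₁ σ x = x)
    (htriv₂ : ∀ (σ : absoluteGaloisGroup (v.adicCompletion K)) (x : N₂), ρ₂ σ x = x)
    (g : N₁ →+ N₂) (Φ : galoisCohomology ρ₁ 1 →+ galoisCohomology ρ₂ 1)
    (hΦ : ∀ z : contOneCocycles ρ₁.toTopRep, ∃ z' : contOneCocycles ρ₂.toTopRep,
      oneCocycleClass ρ₂.toTopRep z' = Φ (oneCocycleClass ρ₁.toTopRep z) ∧ ∀ γ, z'.1 γ = g (z.1 γ))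
    (γ : absoluteGaloisGroup (v.adicCompletion K)) (c : galoisCohomology ρ₁ 1) :
    evalClass ρ₂ htriv₂ γ (Φ c) = g (evalClass ρ₁ htriv₁ γ c) := by
  obtain ⟨z, rfl⟩ := oneCocycleClass_surjective ρ₁.toTopRep c
  obtain ⟨z', hz', hγ⟩ := hΦ z
  rw [← hz', evalClass_oneCocycleClass, evalClass_oneCocycleClass, hγ]

/-- **Naturality of `fs` along any value-compatible pair `(Φ, Ψ)`**: if `Φ` acts on cocycle values
through the additive `g : N₁ → N₂` and `Ψ` is the map it induces on singular quotients
(`Ψ ∘ loc^s = loc^s ∘ Φ`), then `fs₂ (Φ c) = (Ψ ⊗ 1) (fs₁ c)` for ALL `c` — both factors of `fs` are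
evaluations of cocycles (Prop. 1.1.7), which commute with `g`.
[cite: Howard2004HeegnerKolyvagin, Prop. 1.1.7 / Def. 1.1.8 (arXiv p. 5, L129–149)] -/
theorem TamePin.fs_natural_of_eval (π : TamePin v) (ρ₁ : DiscreteGaloisModule (v.adicCompletion K) N₁)
    (ρ₂ : DiscreteGaloisModule (v.adicCompletion K) N₂) [Finite N₁] [Finite N₂]
    (htriv₁ : ∀ (σ : absoluteGaloisGroup (v.adicCompletion K)) (x : N₁), ρ₁ σ x = x)
    (htriv₂ : ∀ (σ : absoluteGaloisGroup (v.adicCompletion K)) (x : N₂), ρ₂ σ x = x)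
    (hq₁ : ∀ x : N₁, (residueFieldCard (v.adicCompletion K) - 1) • x = 0)
    (hq₂ : ∀ x : N₂, (residueFieldCard (v.adicCompletion K) - 1) • x = 0)
    (g : N₁ →+ N₂) (Φ : galoisCohomology ρ₁ 1 →+ galoisCohomology ρ₂ 1)
    (hΦ : ∀ z : contOneCocycles ρ₁.toTopRep, ∃ z' : contOneCocycles ρ₂.toTopRep,
      oneCocycleClass ρ₂.toTopRep z' = Φ (oneCocycleClass ρ₁.toTopRep z) ∧ ∀ γ, z'.1 γ = g (z.1 γ))
    (Ψ : SingularQuotient ρ₁ →+ SingularQuotient ρ₂)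
    (hΨ : ∀ x : galoisCohomology ρ₁ 1, Ψ (singularMap ρ₁ x) = singularMap ρ₂ (Φ x))
    (c : galoisCohomology ρ₁ 1) :
    π.fs ρ₂ htriv₂ hq₂ (Φ c) = TensorProduct.map Ψ.toIntLinearMap LinearMap.id (π.fs ρ₁ htriv₁ hq₁ c) := by
  rw [TamePin.fs_apply, TamePin.fs_apply, TensorProduct.map_tmul, LinearMap.id_apply,
    AddMonoidHom.coe_toIntLinearMap]
  congr 1
  apply singularEval_injective ρ₂ htriv₂ π.isTameGenerator hq₂
  rw [TamePin.singularEval_fsFactor π _ htriv₂ hq₂,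
    evalClass_eq_of_exists_cocycle ρ₁ ρ₂ htriv₁ htriv₂ g Φ hΦ]
  -- the right-hand factor: `singularEval₂ (Ψ y) = g (singularEval₁ y)`
  set y := (AddEquiv.ofBijective (singularEval ρ₁ htriv₁ π.gen)
    (singularEval_bijective ρ₁ htriv₁ π.isTameGenerator hq₁)).symm (evalClass ρ₁ htriv₁ π.frob c)
  have hy' : singularEval ρ₁ htriv₁ π.gen y = evalClass ρ₁ htriv₁ π.frob c :=
    TamePin.singularEval_fsFactor π _ htriv₁ hq₁ c
  obtain ⟨x, hx⟩ := QuotientAddGroup.mk_surjective y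
  rw [← hy', ← hx]
  change g (singularEval ρ₁ htriv₁ π.gen (singularMap ρ₁ x)) = singularEval ρ₂ htriv₂ π.gen (Ψ (singularMap ρ₁ x))
  rw [hΨ, singularEval_singularMap, singularEval_singularMap,
    evalClass_eq_of_exists_cocycle ρ₁ ρ₂ htriv₁ htriv₂ g Φ hΦ]

/-- `ContinuousRep.cohomologyMap` of an equivariant additive `g` acts on cocycle values through `g`
(the hypothesis `hΦ` of `fs_natural_of_eval`; e.g. `DVRSetting.rqLocH1`).
[cite: SerreGaloisCohomology1997, I §2.2] -/
theorem exists_cocycle_cohomologyMap (ρ₁ : DiscreteGaloisModule (v.adicCompletion K) N₁)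
    (ρ₂ : DiscreteGaloisModule (v.adicCompletion K) N₂) (g : N₁ →+ N₂)
    (hg : ∀ (σ : absoluteGaloisGroup (v.adicCompletion K)) (x : N₁), g (ρ₁ σ x) = ρ₂ σ (g x))
    (z : contOneCocycles ρ₁.toTopRep) :
    ∃ z' : contOneCocycles ρ₂.toTopRep,
      oneCocycleClass ρ₂.toTopRep z' =
          ContinuousRep.cohomologyMap ρ₁ ρ₂ g continuous_of_discreteTopology hg 1
            (oneCocycleClass ρ₁.toTopRep z) ∧
        ∀ γ, z'.1 γ = g (z.1 γ) :=
  ⟨_, (cohomologyMap_one_oneCocycleClass ρ₁ ρ₂ g hg z).symm, fun _ => rfl⟩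

/-- **`fs` commutes with `ContinuousRep.cohomologyMap` of an equivariant additive `g`**, for any map
`Ψ` of singular quotients compatible with it (the shape of `DVRSetting.SatisfiesH.fs_natural` with
`rqLocH1`, `fsQ`, `fsQ_spec`). [cite: Howard2004HeegnerKolyvagin, Prop. 1.1.7 / Def. 1.1.8 (arXiv p. 5, L129–149)] -/
theorem TamePin.fs_natural_cohomologyMap (π : TamePin v) (ρ₁ : DiscreteGaloisModule (v.adicCompletion K) N₁)
    (ρ₂ : DiscreteGaloisModule (v.adicCompletion K) N₂) [Finite N₁] [Finite N₂]
    (htriv₁ : ∀ (σ : absoluteGaloisGroup (v.adicCompletion K)) (x : N₁), ρ₁ σ x = x)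
    (htriv₂ : ∀ (σ : absoluteGaloisGroup (v.adicCompletion K)) (x : N₂), ρ₂ σ x = x)
    (hq₁ : ∀ x : N₁, (residueFieldCard (v.adicCompletion K) - 1) • x = 0)
    (hq₂ : ∀ x : N₂, (residueFieldCard (v.adicCompletion K) - 1) • x = 0)
    (g : N₁ →+ N₂) (hg : ∀ (σ : absoluteGaloisGroup (v.adicCompletion K)) (x : N₁), g (ρ₁ σ x) = ρ₂ σ (g x))
    (Ψ : SingularQuotient ρ₁ →+ SingularQuotient ρ₂)
    (hΨ : ∀ x : galoisCohomology ρ₁ 1, Ψ (singularMap ρ₁ x) =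
      singularMap ρ₂ (ContinuousRep.cohomologyMap ρ₁ ρ₂ g continuous_of_discreteTopology hg 1 x))
    (c : galoisCohomology ρ₁ 1) :
    π.fs ρ₂ htriv₂ hq₂ (ContinuousRep.cohomologyMap ρ₁ ρ₂ g continuous_of_discreteTopology hg 1 c) =
      TensorProduct.map Ψ.toIntLinearMap LinearMap.id (π.fs ρ₁ htriv₁ hq₁ c) :=
  π.fs_natural_of_eval ρ₁ ρ₂ htriv₁ htriv₂ hq₁ hq₂ g _ (exists_cocycle_cohomologyMap ρ₁ ρ₂ g hg) Ψ hΨ c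

end Natural

/-! ## §2 The tame slot with a level-independent guard -/

section Guard

variable {K : Type} [Field K] [NumberField K]
  {N : Finset (HeightOneSpectrum (𝓞 K)) → Type} [∀ n, AddCommGroup (N n)]
  [∀ n, TopologicalSpace (N n)] [∀ n, DiscreteTopology (N n)]
  {N' : Finset (HeightOneSpectrum (𝓞 K)) → Type} [∀ n, AddCommGroup (N' n)]
  [∀ n, TopologicalSpace (N' n)] [∀ n, DiscreteTopology (N' n)]

/-- **The guarded tame slot**: at the pairs `(n, v)` selected by the guard `P` (which certifies the
hypotheses of Def. 1.1.8 there, `hP`), Howard's finite–singular map with the pin `π v`; `0` elsewhere.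
With `P` independent of the presentation (e.g. `P n v := ↑n ⊆ 𝓛 ∧ v ∈ n`) the slots of all levels of
a tower are guarded alike, which the all-pairs naturality `DVRSetting.SatisfiesH.fs_natural` needs.
[cite: Howard2004HeegnerKolyvagin, Def. 1.1.8 / Def. 1.2.3 and §1.6 (arXiv p. 5 L144–149, p. 6 L126–131, p. 11 L45–54)] -/
def tameSlotOn [∀ n, Finite (N n)] (π : ∀ v : HeightOneSpectrum (𝓞 K), TamePin v)
    (ρq : ∀ n, DiscreteGaloisModule K (N n))
    (P : Finset (HeightOneSpectrum (𝓞 K)) → HeightOneSpectrum (𝓞 K) → Prop)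
    (hP : ∀ n v, P n v → TameHyp ρq n v) (n : Finset (HeightOneSpectrum (𝓞 K)))
    (v : HeightOneSpectrum (𝓞 K)) :
    galoisCohomology (GaloisRep.toLocal v (ρq n)) 1 →+
      SingularQuotient (GaloisRep.toLocal v (ρq n)) ⊗[ℤ] Gell v :=
  if h : P n v then (π v).fs (GaloisRep.toLocal v (ρq n)) (hP n v h).1 (hP n v h).2 else 0

/-- Unfolding the guarded slot on the guard. [cite: Howard2004HeegnerKolyvagin, Def. 1.1.8 (arXiv p. 5)] -/
theorem tameSlotOn_eq_of [∀ n, Finite (N n)] (π : ∀ v : HeightOneSpectrum (𝓞 K), TamePin v)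
    (ρq : ∀ n, DiscreteGaloisModule K (N n))
    (P : Finset (HeightOneSpectrum (𝓞 K)) → HeightOneSpectrum (𝓞 K) → Prop)
    (hP : ∀ n v, P n v → TameHyp ρq n v) {n : Finset (HeightOneSpectrum (𝓞 K))}
    {v : HeightOneSpectrum (𝓞 K)} (h : P n v) :
    tameSlotOn π ρq P hP n v = (π v).fs (GaloisRep.toLocal v (ρq n)) (hP n v h).1 (hP n v h).2 := by
  rw [tameSlotOn, dif_pos h]

/-- Off the guard the slot is `0`. [cite: Howard2004HeegnerKolyvagin, Def. 1.2.3 (arXiv p. 6, L126–131: the slot is used at `λ ∈ n ∈ 𝓝(𝓛)` only)] -/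
theorem tameSlotOn_eq_zero_of [∀ n, Finite (N n)] (π : ∀ v : HeightOneSpectrum (𝓞 K), TamePin v)
    (ρq : ∀ n, DiscreteGaloisModule K (N n))
    (P : Finset (HeightOneSpectrum (𝓞 K)) → HeightOneSpectrum (𝓞 K) → Prop)
    (hP : ∀ n v, P n v → TameHyp ρq n v) {n : Finset (HeightOneSpectrum (𝓞 K))}
    {v : HeightOneSpectrum (𝓞 K)} (h : ¬ P n v) : tameSlotOn π ρq P hP n v = 0 := by
  rw [tameSlotOn, dif_neg h]

/-- **The guarded slots of two presentations with THE SAME guard commute with every value-compatible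
pair `(Φ, Ψ)` at EVERY `(n, v)`** (on the guard by `fs_natural_of_eval`, off it both vanish).
[cite: Howard2004HeegnerKolyvagin, Prop. 1.1.7 / Def. 1.1.8 and §1.6 (arXiv p. 5 L129–149, p. 11 L45–54)] -/
theorem tameSlotOn_natural [∀ n, Finite (N n)] [∀ n, Finite (N' n)]
    (π : ∀ v : HeightOneSpectrum (𝓞 K), TamePin v)
    (ρq : ∀ n, DiscreteGaloisModule K (N n)) (ρq' : ∀ n, DiscreteGaloisModule K (N' n))
    (P : Finset (HeightOneSpectrum (𝓞 K)) → HeightOneSpectrum (𝓞 K) → Prop)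
    (hP : ∀ n v, P n v → TameHyp ρq n v) (hP' : ∀ n v, P n v → TameHyp ρq' n v)
    (n : Finset (HeightOneSpectrum (𝓞 K))) (v : HeightOneSpectrum (𝓞 K)) (g : N n →+ N' n)
    (Φ : galoisCohomology (GaloisRep.toLocal v (ρq n)) 1 →+ galoisCohomology (GaloisRep.toLocal v (ρq' n)) 1)
    (hΦ : ∀ z : contOneCocycles (DiscreteGaloisModule.toTopRep (GaloisRep.toLocal v (ρq n))),
      ∃ z' : contOneCocycles (DiscreteGaloisModule.toTopRep (GaloisRep.toLocal v (ρq' n))),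
        oneCocycleClass _ z' = Φ (oneCocycleClass _ z) ∧ ∀ γ, z'.1 γ = g (z.1 γ))
    (Ψ : SingularQuotient (GaloisRep.toLocal v (ρq n)) →+ SingularQuotient (GaloisRep.toLocal v (ρq' n)))
    (hΨ : ∀ x, Ψ (singularMap _ x) = singularMap _ (Φ x))
    (c : galoisCohomology (GaloisRep.toLocal v (ρq n)) 1) :
    tameSlotOn π ρq' P hP' n v (Φ c) =
      TensorProduct.map Ψ.toIntLinearMap LinearMap.id (tameSlotOn π ρq P hP n v c) := by
  by_cases h : P n v
  · rw [tameSlotOn_eq_of π ρq P hP h, tameSlotOn_eq_of π ρq' P hP' h]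
    exact (π v).fs_natural_of_eval _ _ (hP n v h).1 (hP' n v h).1 (hP n v h).2 (hP' n v h).2 g Φ hΦ Ψ hΨ c
  · rw [tameSlotOn_eq_zero_of π ρq P hP h, tameSlotOn_eq_zero_of π ρq' P hP' h]
    simp

/-- **The guarded slots commute with `ContinuousRep.cohomologyMap` of equivariant additive level maps**
(`g n : N n → N' n`), for any compatible maps `Ψ` of singular quotients — the body of
`DVRSetting.SatisfiesH.fs_natural` (`rqLocH1 = cohomologyMap (rq k n)`, `Ψ = fsQ k n v`, `fsQ_spec`).
[cite: Howard2004HeegnerKolyvagin, Prop. 1.1.7 / Def. 1.1.8 and §1.6 (arXiv p. 5 L129–149, p. 11 L45–54)] -/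
theorem tameSlotOn_natural_cohomologyMap [∀ n, Finite (N n)] [∀ n, Finite (N' n)]
    (π : ∀ v : HeightOneSpectrum (𝓞 K), TamePin v)
    (ρq : ∀ n, DiscreteGaloisModule K (N n)) (ρq' : ∀ n, DiscreteGaloisModule K (N' n))
    (P : Finset (HeightOneSpectrum (𝓞 K)) → HeightOneSpectrum (𝓞 K) → Prop)
    (hP : ∀ n v, P n v → TameHyp ρq n v) (hP' : ∀ n v, P n v → TameHyp ρq' n v)
    (n : Finset (HeightOneSpectrum (𝓞 K))) (v : HeightOneSpectrum (𝓞 K)) (g : N n →+ N' n)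
    (hg : ∀ (σ : absoluteGaloisGroup (v.adicCompletion K)) (x : N n),
      g (GaloisRep.toLocal v (ρq n) σ x) = GaloisRep.toLocal v (ρq' n) σ (g x))
    (Ψ : SingularQuotient (GaloisRep.toLocal v (ρq n)) →+ SingularQuotient (GaloisRep.toLocal v (ρq' n)))
    (hΨ : ∀ x, Ψ (singularMap _ x) = singularMap _
      (ContinuousRep.cohomologyMap (GaloisRep.toLocal v (ρq n)) (GaloisRep.toLocal v (ρq' n)) g
        continuous_of_discreteTopology hg 1 x))
    (c : galoisCohomology (GaloisRep.toLocal v (ρq n)) 1) :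
    tameSlotOn π ρq' P hP' n v
        (ContinuousRep.cohomologyMap (GaloisRep.toLocal v (ρq n)) (GaloisRep.toLocal v (ρq' n)) g
          continuous_of_discreteTopology hg 1 c) =
      TensorProduct.map Ψ.toIntLinearMap LinearMap.id (tameSlotOn π ρq P hP n v c) :=
  tameSlotOn_natural π ρq ρq' P hP hP' n v g _
    (exists_cocycle_cohomologyMap (GaloisRep.toLocal v (ρq n)) (GaloisRep.toLocal v (ρq' n)) g hg) Ψ hΨ c

end Guard

/-! ## §3 Admissibility of the guarded slot; the constructor `LevelData.withTameSlotOn` -/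

section Admissible

variable {K : Type} [Field K] [NumberField K] {M : Type} [AddCommGroup M] [TopologicalSpace M]
  [DiscreteTopology M] {R : Type} [CommRing R] [Module R M]
  {p : ℕ} {ρ : DiscreteGaloisModule K M} {t : SelmerTriple p ρ}
  {N : Finset (HeightOneSpectrum (𝓞 K)) → Type} [∀ n, AddCommGroup (N n)]
  [∀ n, TopologicalSpace (N n)] [∀ n, DiscreteTopology (N n)] [∀ n, Module R (N n)]

/-- **A `LevelData` whose slot is the guarded tame slot is `IsFsAdmissible` as soon as the guard
contains the level pairs `λ ∈ n ∈ 𝓝(𝓛)`** (the guard itself certifies Def. 1.1.8's hypotheses there;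
`#G_ℓ·(T/I_nT) = 0` by `natCard_gell_smul_eq_zero_of_mem_level`).
[cite: Howard2004HeegnerKolyvagin, Def. 1.1.8 and Def. 1.2.3 (arXiv p. 5 L144–149, p. 6 L126 – p. 7 L12)] -/
theorem LevelData.isFsAdmissible_of_fs_eq_tameSlotOn [Fact p.Prime] [∀ n, Finite (N n)]
    (D : LevelData R ρ t N) (π : ∀ v : HeightOneSpectrum (𝓞 K), TamePin v)
    (P : Finset (HeightOneSpectrum (𝓞 K)) → HeightOneSpectrum (𝓞 K) → Prop)
    (hP : ∀ n v, P n v → TameHyp D.ρq n v) (hfs : D.fs = tameSlotOn π D.ρq P hP)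
    (hPlev : ∀ n ∈ t.levelSet, ∀ v ∈ n, P n v) : D.IsFsAdmissible := by
  intro n hn v hv
  refine ⟨?_, fun n' hn' hv' => ?_⟩
  · change Function.Bijective fun x : unramifiedSubgroup (GaloisRep.toLocal v (D.ρq n)) 1 =>
      D.fs n v (x : galoisCohomology (GaloisRep.toLocal v (D.ρq n)) 1)
    rw [hfs]
    simp_rw [tameSlotOn_eq_of π D.ρq P hP (hPlev n hn v hv)]
    exact (π v).fs_bijective_unramified (GaloisRep.toLocal v (D.ρq n)) _ _
      (natCard_gell_smul_eq_zero_of_mem_level D hn hv)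
  · intro g hg c _
    rw [hfs, tameSlotOn_eq_of π D.ρq P hP (hPlev n hn v hv), tameSlotOn_eq_of π D.ρq P hP (hPlev n' hn' v hv')]
    exact (π v).fs_natural (D.ρq n) (D.ρq n') g.toAddMonoidHom hg _ _ _ _ c

/-- **The guard proof for the level-independent guard `P n v := n ∈ 𝓝(𝓛) ∧ v ∈ n`** of a tower all
of whose level triples have the prime set `𝓛` (`t.primes = 𝓛`), given that the Frobenius elements at
`λ ∈ n` act trivially on the presentation of `T/I_nT` (`tameHyp_of_mem_level`).
[cite: Howard2004HeegnerKolyvagin, Def. 1.1.8, Def. 1.2.1–1.2.3 (arXiv pp. 5–7)] -/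
theorem tameHyp_of_mem_levels (D : LevelData R ρ t N) {L : Set (HeightOneSpectrum (𝓞 K))}
    (hL : t.primes = L)
    (hFrob : ∀ n ∈ levels L, ∀ v ∈ n, ∀ σ : absoluteGaloisGroup K, IsArithFrobAtPlace K v σ →
      ∀ x : N n, D.ρq n σ x = x)
    (n : Finset (HeightOneSpectrum (𝓞 K))) (v : HeightOneSpectrum (𝓞 K)) (h : n ∈ levels L ∧ v ∈ n) :
    TameHyp D.ρq n v := by
  subst hL
  exact tameHyp_of_mem_level D (n := n) h.1 h.2 (hFrob n h.1 v h.2)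

/-- The same under H.0 (`T` free of rank two: `Frob_λ ≡ 1` on `T/I_nT` for `λ ∈ n`,
`LevelData.ρq_apply_eq_self_of_h0`). [cite: Howard2004HeegnerKolyvagin, Def. 1.1.8, Def. 1.2.1–1.2.3 and H.0 (arXiv pp. 5–7)] -/
theorem tameHyp_of_mem_levels_of_h0 (h0 : H0 R M) (D : LevelData R ρ t N)
    {L : Set (HeightOneSpectrum (𝓞 K))} (hL : t.primes = L)
    (n : Finset (HeightOneSpectrum (𝓞 K))) (v : HeightOneSpectrum (𝓞 K)) (h : n ∈ levels L ∧ v ∈ n) :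
    TameHyp D.ρq n v :=
  tameHyp_of_mem_levels D hL (fun _ _ _ hv _ hσ x => D.ρq_apply_eq_self_of_h0 h0 hv hσ x) n v h

/-- The same for `T` free over `R`. [cite: Howard2004HeegnerKolyvagin, Def. 1.1.8, Def. 1.2.1–1.2.3 and H.0 (arXiv pp. 5–7)] -/
theorem tameHyp_of_mem_levels_of_free [Module.Free R M] (D : LevelData R ρ t N)
    {L : Set (HeightOneSpectrum (𝓞 K))} (hL : t.primes = L)
    (n : Finset (HeightOneSpectrum (𝓞 K))) (v : HeightOneSpectrum (𝓞 K)) (h : n ∈ levels L ∧ v ∈ n) :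
    TameHyp D.ρq n v :=
  tameHyp_of_mem_levels D hL (fun _ _ _ hv _ hσ x => D.ρq_apply_eq_self_of_free hv hσ x) n v h

/-- The same over a DVR level ring with `ℓ + 1 ≠ 0` for `ℓ ∈ 𝓛`, any `T`.
[cite: Howard2004HeegnerKolyvagin, Def. 1.1.8, Def. 1.2.1–1.2.3 (arXiv pp. 5–7)] -/
theorem tameHyp_of_mem_levels_of_isDiscreteValuationRing [IsDomain R] [IsDiscreteValuationRing R]
    (D : LevelData R ρ t N) {L : Set (HeightOneSpectrum (𝓞 K))} (hL : t.primes = L)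
    (hℓ : ∀ v ∈ L, ((residueChar v + 1 : ℕ) : R) ≠ 0)
    (n : Finset (HeightOneSpectrum (𝓞 K))) (v : HeightOneSpectrum (𝓞 K)) (h : n ∈ levels L ∧ v ∈ n) :
    TameHyp D.ρq n v :=
  tameHyp_of_mem_levels D hL
    (fun _ hn _ hv _ hσ x => D.ρq_apply_eq_self_of_isDiscreteValuationRing hv (hℓ _ (hn hv)) hσ x) n v h

/-- **With the guard `n ∈ 𝓝(𝓛) ∧ v ∈ n` (`t.primes = 𝓛`), the guarded tame slot is admissible.**
[cite: Howard2004HeegnerKolyvagin, Def. 1.1.8 and Def. 1.2.3 (arXiv p. 5 L144–149, p. 6 L126 – p. 7 L12)] -/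
theorem LevelData.isFsAdmissible_of_fs_eq_tameSlotOn_levels [Fact p.Prime] [∀ n, Finite (N n)]
    (D : LevelData R ρ t N) (π : ∀ v : HeightOneSpectrum (𝓞 K), TamePin v)
    {L : Set (HeightOneSpectrum (𝓞 K))} (hL : t.primes = L)
    (hP : ∀ n v, n ∈ levels L ∧ v ∈ n → TameHyp D.ρq n v)
    (hfs : D.fs = tameSlotOn π D.ρq (fun n v => n ∈ levels L ∧ v ∈ n) hP) : D.IsFsAdmissible :=
  D.isFsAdmissible_of_fs_eq_tameSlotOn π _ hP hfs fun _ hn _ hv => ⟨hL ▸ hn, hv⟩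

/-- **Constructor: replace the finite–singular slot of a `LevelData` by the guarded tame slot**
(same presentations `T ↠ T/I_nT`, same actions).  Intended use, for a tower with prime set `𝓛`:
`LD k := (D₀ k).withTameSlotOn π (fun n v => n ∈ levels 𝓛 ∧ v ∈ n) (tameHyp_of_mem_levels_of_h0 …)`.
[cite: Howard2004HeegnerKolyvagin, Def. 1.1.8 / Def. 1.2.3 (arXiv p. 5 L144–149, p. 7 L1–12)] -/
def LevelData.withTameSlotOn [∀ n, Finite (N n)] (D : LevelData R ρ t N)
    (π : ∀ v : HeightOneSpectrum (𝓞 K), TamePin v)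
    (P : Finset (HeightOneSpectrum (𝓞 K)) → HeightOneSpectrum (𝓞 K) → Prop)
    (hP : ∀ n v, P n v → TameHyp D.ρq n v) : LevelData R ρ t N :=
  { D with fs := tameSlotOn π D.ρq P hP }

/-- The actions are unchanged. [cite: Howard2004HeegnerKolyvagin, Def. 1.2.3 (arXiv p. 7, L1–12)] -/
@[simp] theorem LevelData.withTameSlotOn_ρq [∀ n, Finite (N n)] (D : LevelData R ρ t N)
    (π : ∀ v : HeightOneSpectrum (𝓞 K), TamePin v)
    (P : Finset (HeightOneSpectrum (𝓞 K)) → HeightOneSpectrum (𝓞 K) → Prop)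
    (hP : ∀ n v, P n v → TameHyp D.ρq n v) : (D.withTameSlotOn π P hP).ρq = D.ρq :=
  rfl

/-- The presentations are unchanged. [cite: Howard2004HeegnerKolyvagin, Def. 1.2.3 (arXiv p. 7, L1–12)] -/
@[simp] theorem LevelData.withTameSlotOn_π [∀ n, Finite (N n)] (D : LevelData R ρ t N)
    (π : ∀ v : HeightOneSpectrum (𝓞 K), TamePin v)
    (P : Finset (HeightOneSpectrum (𝓞 K)) → HeightOneSpectrum (𝓞 K) → Prop)
    (hP : ∀ n v, P n v → TameHyp D.ρq n v) : (D.withTameSlotOn π P hP).π = D.π :=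
  rfl

/-- The slot is the guarded tame slot. [cite: Howard2004HeegnerKolyvagin, Def. 1.1.8 (arXiv p. 5, L144–149)] -/
theorem LevelData.withTameSlotOn_fs [∀ n, Finite (N n)] (D : LevelData R ρ t N)
    (π : ∀ v : HeightOneSpectrum (𝓞 K), TamePin v)
    (P : Finset (HeightOneSpectrum (𝓞 K)) → HeightOneSpectrum (𝓞 K) → Prop)
    (hP : ∀ n v, P n v → TameHyp D.ρq n v) :
    (D.withTameSlotOn π P hP).fs = tameSlotOn π D.ρq P hP :=
  rfl

/-- **`D.withTameSlotOn π P hP` is `IsFsAdmissible` whenever the guard contains the level pairs.**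
[cite: Howard2004HeegnerKolyvagin, Def. 1.1.8 and Def. 1.2.3 (arXiv p. 5 L144–149, p. 6 L126 – p. 7 L12)] -/
theorem LevelData.withTameSlotOn_isFsAdmissible [Fact p.Prime] [∀ n, Finite (N n)]
    (D : LevelData R ρ t N) (π : ∀ v : HeightOneSpectrum (𝓞 K), TamePin v)
    (P : Finset (HeightOneSpectrum (𝓞 K)) → HeightOneSpectrum (𝓞 K) → Prop)
    (hP : ∀ n v, P n v → TameHyp D.ρq n v) (hPlev : ∀ n ∈ t.levelSet, ∀ v ∈ n, P n v) :
    (D.withTameSlotOn π P hP).IsFsAdmissible :=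
  (D.withTameSlotOn π P hP).isFsAdmissible_of_fs_eq_tameSlotOn π P hP rfl hPlev

end Admissible

/-! ## §4 Tower form: the clauses `fs_natural` / `fs_admissible` of `DVRSetting.SatisfiesH` and
`CoeffTowerSetting.FsNatural` / `FsAdmissible` for guarded tame slots -/

section Tower

variable {p : ℕ} [Fact p.Prime] {K : Type} [Field K] [NumberField K]
  {R : Type} [CommRing R] [IsLocalRing R] [Algebra ℤ_[p] R]
  {N : ℕ → Type} [∀ k, AddCommGroup (N k)] [∀ k, TopologicalSpace (N k)]
  [∀ k, DiscreteTopology (N k)] [∀ k, Module R (N k)]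
  {Rk : ℕ → Type} [∀ k, CommRing (Rk k)] [∀ k, IsLocalRing (Rk k)] [∀ k, TopologicalSpace (Rk k)]
  [∀ k, DiscreteTopology (Rk k)] [∀ k, Algebra ℤ_[p] (Rk k)] [∀ k, Algebra R (Rk k)]
  [∀ k, Module (Rk k) (N k)] [∀ k, IsScalarTower R (Rk k) (N k)]
  {Nbar : Type} [AddCommGroup Nbar] [TopologicalSpace Nbar] [DiscreteTopology Nbar]
  [∀ k, Module (Rk k) Nbar]
  {Nq : ℕ → Finset (HeightOneSpectrum (𝓞 K)) → Type} [∀ k n, AddCommGroup (Nq k n)]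
  [∀ k n, TopologicalSpace (Nq k n)] [∀ k n, DiscreteTopology (Nq k n)]
  [∀ k n, Module (Rk k) (Nq k n)] [∀ k n, Module R (Nq k n)]
  [∀ k n, IsScalarTower R (Rk k) (Nq k n)]

/-- **`CoeffTowerSetting.FsNatural` for guarded tame slots**: if every level's slot is the guarded
tame slot for ONE guard `P`, and `fsQ` is the induced map on singular quotients (`fsQ_spec`), the
slots commute with the reductions `T^{(k+1)}/I_n → T^{(k)}/I_n` at every `(k, n, v)`.
[cite: Howard2004HeegnerKolyvagin, Def. 1.2.3 display (ks relations) and §1.6 (arXiv p. 6 L126–140, p. 11 L45–54)] -/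
theorem CoeffTowerSetting.fsNatural_of_fs_eq_tameSlotOn [∀ k n, Finite (Nq k n)]
    (S : CoeffTowerSetting p K R N Rk Nbar Nq) (π : ∀ v : HeightOneSpectrum (𝓞 K), TamePin v)
    (P : Finset (HeightOneSpectrum (𝓞 K)) → HeightOneSpectrum (𝓞 K) → Prop)
    (hP : ∀ k n v, P n v → TameHyp (S.LD k).ρq n v)
    (hfs : ∀ k, (S.LD k).fs = tameSlotOn π (S.LD k).ρq P (hP k))
    (fsQ_spec : ∀ k n (v : HeightOneSpectrum (𝓞 K))
      (x : galoisCohomology (GaloisRep.toLocal v ((S.LD (k + 1)).ρq n)) 1),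
      S.fsQ k n v (singularMap _ x) = singularMap _ (S.rqLocH1 k n v x)) :
    S.FsNatural := by
  refine ⟨fsQ_spec, fun k n v x => ?_⟩
  rw [hfs k, hfs (k + 1)]
  exact tameSlotOn_natural_cohomologyMap π ((S.LD (k + 1)).ρq) ((S.LD k).ρq) P (hP (k + 1)) (hP k)
    n v (S.rq k n).toAddMonoidHom (fun σ y => S.rq_equivariant k n _ y) (S.fsQ k n v)
    (fsQ_spec k n v) x

/-- **`CoeffTowerSetting.FsAdmissible` for guarded tame slots**, when the guard contains the level
pairs of every level triple. [cite: Howard2004HeegnerKolyvagin, Def. 1.1.8 and Def. 1.2.3 (arXiv p. 5 L144–149, p. 7 L1–12)] -/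
theorem CoeffTowerSetting.fsAdmissible_of_fs_eq_tameSlotOn [∀ k n, Finite (Nq k n)]
    (S : CoeffTowerSetting p K R N Rk Nbar Nq) (π : ∀ v : HeightOneSpectrum (𝓞 K), TamePin v)
    (P : Finset (HeightOneSpectrum (𝓞 K)) → HeightOneSpectrum (𝓞 K) → Prop)
    (hP : ∀ k n v, P n v → TameHyp (S.LD k).ρq n v)
    (hfs : ∀ k, (S.LD k).fs = tameSlotOn π (S.LD k).ρq P (hP k))
    (hPlev : ∀ k, ∀ n ∈ (S.t k).levelSet, ∀ v ∈ n, P n v) : S.FsAdmissible :=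
  fun k => (S.LD k).isFsAdmissible_of_fs_eq_tameSlotOn π P (hP k) (hfs k) (hPlev k)

/-- With the canonical guard `n ∈ 𝓝(𝓛) ∧ v ∈ n` of the setting's own prime set `S.L`
(`(S.t k).primes = S.L` at every level): `FsAdmissible`. [cite: Howard2004HeegnerKolyvagin, Def. 1.1.8, Def. 1.2.3 and §1.6 (arXiv pp. 5–7, 11)] -/
theorem CoeffTowerSetting.fsAdmissible_of_fs_eq_tameSlotOn_levels [∀ k n, Finite (Nq k n)]
    (S : CoeffTowerSetting p K R N Rk Nbar Nq) (π : ∀ v : HeightOneSpectrum (𝓞 K), TamePin v)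
    (hL : ∀ k, (S.t k).primes = S.L)
    (hP : ∀ k n v, n ∈ levels S.L ∧ v ∈ n → TameHyp (S.LD k).ρq n v)
    (hfs : ∀ k, (S.LD k).fs = tameSlotOn π (S.LD k).ρq (fun n v => n ∈ levels S.L ∧ v ∈ n) (hP k)) :
    S.FsAdmissible :=
  fun k => (S.LD k).isFsAdmissible_of_fs_eq_tameSlotOn_levels π (hL k) (hP k) (hfs k)

variable {R' : Type} [CommRing R'] [IsDomain R'] [IsDiscreteValuationRing R'] [Algebra ℤ_[p] R']
  {N' : ℕ → Type} [∀ k, AddCommGroup (N' k)] [∀ k, TopologicalSpace (N' k)]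
  [∀ k, DiscreteTopology (N' k)] [∀ k, Module R' (N' k)]
  {Rk' : ℕ → Type} [∀ k, CommRing (Rk' k)] [∀ k, IsLocalRing (Rk' k)] [∀ k, TopologicalSpace (Rk' k)]
  [∀ k, DiscreteTopology (Rk' k)] [∀ k, Algebra ℤ_[p] (Rk' k)] [∀ k, Algebra R' (Rk' k)]
  [∀ k, Module (Rk' k) (N' k)] [∀ k, IsScalarTower R' (Rk' k) (N' k)]
  {Nbar' : Type} [AddCommGroup Nbar'] [TopologicalSpace Nbar'] [DiscreteTopology Nbar']
  [∀ k, Module (Rk' k) Nbar']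
  {Nq' : ℕ → Finset (HeightOneSpectrum (𝓞 K)) → Type} [∀ k n, AddCommGroup (Nq' k n)]
  [∀ k n, TopologicalSpace (Nq' k n)] [∀ k n, DiscreteTopology (Nq' k n)]
  [∀ k n, Module (Rk' k) (Nq' k n)] [∀ k n, Module R' (Nq' k n)]
  [∀ k n, IsScalarTower R' (Rk' k) (Nq' k n)]

/-- **The clause `fs_natural` of `DVRSetting.SatisfiesH` for guarded tame slots** (one guard `P` at
all levels; `fsQ` pinned by `fsQ_spec`). [cite: Howard2004HeegnerKolyvagin, Def. 1.2.3 display (ks relations) and §1.6 (arXiv p. 6 L126–140, p. 11 L45–54)] -/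
theorem DVRSetting.fs_natural_of_fs_eq_tameSlotOn [∀ k n, Finite (Nq' k n)]
    (S : DVRSetting p K R' N' Rk' Nbar' Nq') (π : ∀ v : HeightOneSpectrum (𝓞 K), TamePin v)
    (P : Finset (HeightOneSpectrum (𝓞 K)) → HeightOneSpectrum (𝓞 K) → Prop)
    (hP : ∀ k n v, P n v → TameHyp (S.LD k).ρq n v)
    (hfs : ∀ k, (S.LD k).fs = tameSlotOn π (S.LD k).ρq P (hP k))
    (fsQ_spec : ∀ k n (v : HeightOneSpectrum (𝓞 K))
      (x : galoisCohomology (GaloisRep.toLocal v ((S.LD (k + 1)).ρq n)) 1),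
      S.fsQ k n v (singularMap _ x) = singularMap _ (S.rqLocH1 k n v x))
    (k : ℕ) (n : Finset (HeightOneSpectrum (𝓞 K))) (v : HeightOneSpectrum (𝓞 K))
    (x : galoisCohomology (GaloisRep.toLocal v ((S.LD (k + 1)).ρq n)) 1) :
    (S.LD k).fs n v (S.rqLocH1 k n v x) =
      TensorProduct.map (S.fsQ k n v).toIntLinearMap LinearMap.id ((S.LD (k + 1)).fs n v x) := by
  rw [hfs k, hfs (k + 1)]
  exact tameSlotOn_natural_cohomologyMap π ((S.LD (k + 1)).ρq) ((S.LD k).ρq) P (hP (k + 1)) (hP k)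
    n v (S.rq k n).toAddMonoidHom (fun σ y => S.rq_equivariant k n _ y) (S.fsQ k n v)
    (fsQ_spec k n v) x

/-- **The clause `fs_admissible` of `DVRSetting.SatisfiesH` for guarded tame slots**, when the guard
contains the level pairs. [cite: Howard2004HeegnerKolyvagin, Def. 1.1.8 and Def. 1.2.3 (arXiv p. 5 L144–149, p. 7 L1–12)] -/
theorem DVRSetting.fs_admissible_of_fs_eq_tameSlotOn [∀ k n, Finite (Nq' k n)]
    (S : DVRSetting p K R' N' Rk' Nbar' Nq') (π : ∀ v : HeightOneSpectrum (𝓞 K), TamePin v)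
    (P : Finset (HeightOneSpectrum (𝓞 K)) → HeightOneSpectrum (𝓞 K) → Prop)
    (hP : ∀ k n v, P n v → TameHyp (S.LD k).ρq n v)
    (hfs : ∀ k, (S.LD k).fs = tameSlotOn π (S.LD k).ρq P (hP k))
    (hPlev : ∀ k, ∀ n ∈ (S.t k).levelSet, ∀ v ∈ n, P n v) (k : ℕ) : (S.LD k).IsFsAdmissible :=
  (S.LD k).isFsAdmissible_of_fs_eq_tameSlotOn π P (hP k) (hfs k) (hPlev k)

/-- With the canonical guard `n ∈ 𝓝(S.L) ∧ v ∈ n` (`(S.t k).primes = S.L`, clause `primes_eq`):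
`fs_admissible`. [cite: Howard2004HeegnerKolyvagin, Def. 1.1.8, Def. 1.2.3 and §1.6 (arXiv pp. 5–7, 11)] -/
theorem DVRSetting.fs_admissible_of_fs_eq_tameSlotOn_levels [∀ k n, Finite (Nq' k n)]
    (S : DVRSetting p K R' N' Rk' Nbar' Nq') (π : ∀ v : HeightOneSpectrum (𝓞 K), TamePin v)
    (hL : ∀ k, (S.t k).primes = S.L)
    (hP : ∀ k n v, n ∈ levels S.L ∧ v ∈ n → TameHyp (S.LD k).ρq n v)
    (hfs : ∀ k, (S.LD k).fs = tameSlotOn π (S.LD k).ρq (fun n v => n ∈ levels S.L ∧ v ∈ n) (hP k))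
    (k : ℕ) : (S.LD k).IsFsAdmissible :=
  (S.LD k).isFsAdmissible_of_fs_eq_tameSlotOn_levels π (hL k) (hP k) (hfs k)

end Tower

end Literature.NumberTheory.GaloisCohomology.Howard2004

end
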